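import Summits.Ventures.PercRepro.RankLevelSetTriangleStar
import Summits.Ventures.PercRepro.RankLevelSetPlaneSix

/-!
# PercRepro — LEMMA V: the triangle count by the V's — the V lemma (p2, gen 18)

Under (C1) (rank-`2` sets have `≤ 3` points) and (C2) (rank-`≤ 3` sets have `≤ 6` points), write `t(x)` for the
number of triangles (`3`-circuits) through `x` and `n = |E|`. Then `3·Σ_x t(x)² ≤ n·Σ_x t(x)`, hence (Cauchy–Schwarz
and the double count `Σ_x t(x) = 3·s₃`) `9·s₃ ≤ n²` — against LEMMA R's `3·s₃ ≤ n·⌊(n − 1)/2⌋`; tight on `M(K₄)`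
(`n = 6`, `s₃ = 4`). In a cell `(p, d)` of the `q = 4` window this is `s₃ ≤ ⌊(p + d)²/9⌋`: `136` at `(8, 27)`.

THE ARGUMENT. Fix a point `a` and two triangles `T = {a, b, c}`, `T' = {a, d, e}` through it (`T ∩ T' = {a}` by
(C1)). If a cross pair `{x, y}` (`x ∈ {b, c}`, `y ∈ {d, e}`) lies on a triangle `{x, y, g}` then `g ∈ cl {x, y} ⊆
cl (T ∪ T')`, a set of rank `≤ 3` (submodularity), so `T ∪ T' ∪ {g}` has `≤ 6` points by (C2): `g` is THE sixth
point, the same for every covered cross pair. Two covered cross pairs sharing a point `x` would give two triangles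
`{x, y, g}`, `{x, y', g}` through `x` and `g`, which coincide by (C1), so `y = y'` — impossible. Hence among the four
cross pairs of `(T, T')` at most two are covered, at least two are UNCOVERED (on no triangle). Counting the triples
`(a, x, y)` with `x, y` neighbours of `a` (points `≠ a` on triangles through `a`) and `{x, y}` uncovered: at least
`2·t(a)·(t(a) − 1)` for each `a` (an ordered pair of distinct triangles through `a` gives two, and a neighbour
determines its triangle); at most `2·t(x)·(n − 1 − 2·t(x))` for each `x` (`a` is a neighbour of `x`, `y` is neither
`x` nor a neighbour of `x`). Summing, `3·Σ t(x)² ≤ n·Σ t(x)`.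

* `covered M x y` — some triangle contains both `x` and `y`; `link M a` — the neighbours of `a`;
  `tris M a`, `ptsOff M a T` — the triangles through `a` and the points of `T` other than `a`, as finsets;
* `not_covered_both` — the V lemma: `{x, y}`, `{x, y'}` (`x ∈ T ∖ a`, `y ≠ y' ∈ T' ∖ a`) are not both covered;
* `two_le_sum_uncovered_cross` — at least two uncovered cross pairs per ordered pair of triangles through `a`;
* `card_link` — `|link M a| = 2·t(a)`;
* the counting half (`three_mul_sum_sq_ncard_trianglesThrough_le`, `nine_mul_ncard_triangles_le_sq`, the core
  forms) is `S1TriangleVCount`.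
Axioms: standard.
-/

open scoped Matroid

namespace PercRepro

namespace S1

open Set

variable {α : Type}

/-- `covered M x y`: some triangle of `M` contains both `x` and `y`. -/
def covered (M : Matroid α) (x y : α) : Prop := ∃ C ∈ ThmN.triangles M, x ∈ C ∧ y ∈ C

/-- `covered` is symmetric. -/
theorem covered_comm (M : Matroid α) {x y : α} : covered M x y ↔ covered M y x := by
  constructor <;> rintro ⟨C, hC, h1, h2⟩ <;> exact ⟨C, hC, h2, h1⟩

open Classical in
/-- `link M a`: the points of `E` other than `a` lying on a triangle through `a` (the neighbours of `a`). -/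
noncomputable def link (M : Matroid α) [M.Finite] (a : α) : Finset α :=
  M.ground_finite.toFinset.filter (fun x => x ≠ a ∧ ∃ C ∈ ThmN.trianglesThrough M a, x ∈ C)

/-- Membership in `link`. -/
theorem mem_link (M : Matroid α) [M.Finite] {a x : α} :
    x ∈ link M a ↔ x ∈ M.E ∧ x ≠ a ∧ ∃ C ∈ ThmN.trianglesThrough M a, x ∈ C := by
  simp only [link, Finset.mem_filter, Set.Finite.mem_toFinset]

/-- `link` is symmetric: a neighbour of `a` has `a` as a neighbour. -/
theorem mem_link_symm (M : Matroid α) [M.Finite] {a x : α} (ha : a ∈ M.E) (hx : x ∈ link M a) :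
    a ∈ link M x := by
  rw [mem_link] at hx ⊢
  obtain ⟨_, hxa, C, hC, hxC⟩ := hx
  exact ⟨ha, hxa.symm, C, ⟨hC.1, hC.2.1, hxC⟩, hC.2.2⟩

/-- The triangles through `a` form a finite set. -/
theorem finite_trianglesThrough (M : Matroid α) [M.Finite] (a : α) : (ThmN.trianglesThrough M a).Finite :=
  M.ground_finite.finite_subsets.subset (fun _ hC => hC.1.subset_ground)

/-- `tris M a`: the triangles through `a`, as a finset. -/
noncomputable def tris (M : Matroid α) [M.Finite] (a : α) : Finset (Set α) :=
  (finite_trianglesThrough M a).toFinset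

/-- Membership in `tris`. -/
theorem mem_tris (M : Matroid α) [M.Finite] {a : α} {T : Set α} :
    T ∈ tris M a ↔ T ∈ ThmN.trianglesThrough M a :=
  Set.Finite.mem_toFinset _

/-- `|tris M a| = t(a)`. -/
theorem card_tris (M : Matroid α) [M.Finite] (a : α) : (tris M a).card = (ThmN.trianglesThrough M a).ncard :=
  (Set.ncard_eq_toFinset_card _ _).symm

open Classical in
/-- `ptsOff M a T`: the points of `E ∩ T` other than `a`, as a finset. -/
noncomputable def ptsOff (M : Matroid α) [M.Finite] (a : α) (T : Set α) : Finset α :=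
  M.ground_finite.toFinset.filter (fun x => x ∈ T ∧ x ≠ a)

/-- Membership in `ptsOff`. -/
theorem mem_ptsOff (M : Matroid α) [M.Finite] {a x : α} {T : Set α} :
    x ∈ ptsOff M a T ↔ x ∈ M.E ∧ x ∈ T ∧ x ≠ a := by
  simp only [ptsOff, Finset.mem_filter, Set.Finite.mem_toFinset]

/-- A triangle through `a` has exactly two points other than `a`. -/
theorem card_ptsOff (M : Matroid α) [M.Finite] {a : α} {T : Set α} (hT : T ∈ ThmN.trianglesThrough M a) :
    (ptsOff M a T).card = 2 := by
  have hTE : T ⊆ M.E := hT.1.subset_ground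
  have hcoe : ((ptsOff M a T : Finset α) : Set α) = T \ {a} := by
    ext x
    rw [Finset.mem_coe, mem_ptsOff, Set.mem_sdiff, Set.mem_singleton_iff]
    constructor
    · rintro ⟨-, h1, h2⟩
      exact ⟨h1, h2⟩
    · rintro ⟨h1, h2⟩
      exact ⟨hTE h1, h1, h2⟩
  rw [← Set.ncard_coe_finset, hcoe, Set.ncard_sdiff_singleton_of_mem hT.2.2, hT.2.1]

/-- Under (C1), distinct triangles through `a` have disjoint sets of further points. -/
theorem pairwiseDisjoint_ptsOff (M : Matroid α) [M.Finite]
    (hC1 : ∀ L ⊆ M.E, M.eRk L = 2 → L.ncard ≤ 3) (a : α) :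
    ((tris M a : Finset (Set α)) : Set (Set α)).PairwiseDisjoint (ptsOff M a) := by
  intro T hT T' hT' hne
  rw [Finset.mem_coe, mem_tris] at hT hT'
  show Disjoint (ptsOff M a T) (ptsOff M a T')
  rw [Finset.disjoint_left]
  intro x hx hx'
  rw [mem_ptsOff] at hx hx'
  have hmem : x ∈ T ∩ T' := ⟨hx.2.1, hx'.2.1⟩
  rw [ThmN.inter_eq_singleton_of_mem_trianglesThrough M hC1 hT hT' hne] at hmem
  exact hx.2.2 hmem

/-- The neighbours of `a` are the further points of the triangles through `a`. -/
theorem link_eq_biUnion [DecidableEq α] (M : Matroid α) [M.Finite] (a : α) :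
    link M a = (tris M a).biUnion (ptsOff M a) := by
  ext x
  rw [mem_link, Finset.mem_biUnion]
  constructor
  · rintro ⟨hxE, hxa, C, hC, hxC⟩
    exact ⟨C, (mem_tris M).2 hC, (mem_ptsOff M).2 ⟨hxE, hxC, hxa⟩⟩
  · rintro ⟨C, hC, hx⟩
    rw [mem_tris] at hC
    rw [mem_ptsOff] at hx
    exact ⟨hx.1, hx.2.2, C, hC, hx.2.1⟩

/-- **`|link M a| = 2·t(a)`** under (C1): the triangles through `a` meet pairwise only in `a`, and each contributes
two neighbours. -/
theorem card_link (M : Matroid α) [M.Finite] (hC1 : ∀ L ⊆ M.E, M.eRk L = 2 → L.ncard ≤ 3) (a : α) :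
    (link M a).card = 2 * (ThmN.trianglesThrough M a).ncard := by
  classical
  rw [link_eq_biUnion, Finset.card_biUnion (pairwiseDisjoint_ptsOff M hC1 a),
    Finset.sum_congr rfl (fun T hT => card_ptsOff M ((mem_tris M).1 hT)), Finset.sum_const, smul_eq_mul,
    card_tris, mul_comm]

/-- A point on a triangle is a nonloop. -/
theorem isNonloop_of_mem_trianglesThrough (M : Matroid α) [M.Finite] {x : α} {C : Set α}
    (hC : C ∈ ThmN.trianglesThrough M x) : M.IsNonloop x := by
  rw [← _root_.Matroid.indep_singleton]
  refine hC.1.ssubset_indep ?_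
  refine (Set.singleton_subset_iff.2 hC.2.2).ssubset_of_ne ?_
  intro h
  have := congrArg Set.ncard h
  rw [Set.ncard_singleton, hC.2.1] at this
  omega

/-- Two triangles through `x` with a second common point `y ≠ x` coincide (under (C1)). -/
theorem eq_of_mem_trianglesThrough_of_mem (M : Matroid α) [M.Finite]
    (hC1 : ∀ L ⊆ M.E, M.eRk L = 2 → L.ncard ≤ 3) {x y : α} {C C' : Set α}
    (hC : C ∈ ThmN.trianglesThrough M x) (hC' : C' ∈ ThmN.trianglesThrough M x)
    (hy : y ∈ C) (hy' : y ∈ C') (hyx : y ≠ x) : C = C' := by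
  by_contra hne
  have h := ThmN.inter_eq_singleton_of_mem_trianglesThrough M hC1 hC hC' hne
  have hmem : y ∈ C ∩ C' := ⟨hy, hy'⟩
  rw [h] at hmem
  exact hyx hmem

/-- **The V lemma**: `T ≠ T'` triangles through `a`, `x ∈ T ∖ a`, `y ≠ y'` in `T' ∖ a`: the pairs `{x, y}` and
`{x, y'}` are not both covered by triangles (under (C1), (C2)). A covering triangle's third point lies in
`cl (T ∪ T')`, a set of rank `≤ 3` with `≤ 6` points, five of them `T ∪ T'`; so both covering triangles pass
through `x` and the same sixth point, hence coincide, forcing `y = y'`. -/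
theorem not_covered_both (M : Matroid α) [M.Finite]
    (hC1 : ∀ L ⊆ M.E, M.eRk L = 2 → L.ncard ≤ 3) (hC2 : ∀ P ⊆ M.E, M.eRk P ≤ 3 → P.ncard ≤ 6)
    {a : α} {T T' : Set α} (hT : T ∈ ThmN.trianglesThrough M a) (hT' : T' ∈ ThmN.trianglesThrough M a)
    (hne : T ≠ T') {x y y' : α} (hx : x ∈ T) (hxa : x ≠ a) (hy : y ∈ T') (hya : y ≠ a)
    (hy' : y' ∈ T') (hy'a : y' ≠ a) (hyy' : y ≠ y') : ¬ (covered M x y ∧ covered M x y') := by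
  rintro ⟨⟨G, hG, hxG, hyG⟩, ⟨G', hG', hxG', hy'G'⟩⟩
  have hTT' : T ∩ T' = {a} := ThmN.inter_eq_singleton_of_mem_trianglesThrough M hC1 hT hT' hne
  have hnotT' : ∀ z ∈ T, z ≠ a → z ∉ T' := by
    intro z hz hza hz'
    have hmem : z ∈ T ∩ T' := ⟨hz, hz'⟩
    rw [hTT'] at hmem
    exact hza hmem
  have hnotT : ∀ z ∈ T', z ≠ a → z ∉ T := by
    intro z hz hza hz'
    have hmem : z ∈ T ∩ T' := ⟨hz', hz⟩
    rw [hTT'] at hmem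
    exact hza hmem
  have hxy : x ≠ y := fun h => hnotT' x hx hxa (h ▸ hy)
  have hxy' : x ≠ y' := fun h => hnotT' x hx hxa (h ▸ hy')
  -- the covering triangles, as triangles through their points
  have hGx : G ∈ ThmN.trianglesThrough M x := ⟨hG.1, hG.2, hxG⟩
  have hGy : G ∈ ThmN.trianglesThrough M y := ⟨hG.1, hG.2, hyG⟩
  have hG'x : G' ∈ ThmN.trianglesThrough M x := ⟨hG'.1, hG'.2, hxG'⟩
  have hG'y' : G' ∈ ThmN.trianglesThrough M y' := ⟨hG'.1, hG'.2, hy'G'⟩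
  have hTx : T ∈ ThmN.trianglesThrough M x := ⟨hT.1, hT.2.1, hx⟩
  have hT'y : T' ∈ ThmN.trianglesThrough M y := ⟨hT'.1, hT'.2.1, hy⟩
  have hT'y' : T' ∈ ThmN.trianglesThrough M y' := ⟨hT'.1, hT'.2.1, hy'⟩
  have hGT : G ≠ T := fun h => hnotT y hy hya (h ▸ hyG)
  have hGT' : G ≠ T' := fun h => hnotT' x hx hxa (h ▸ hxG)
  have hG'T : G' ≠ T := fun h => hnotT y' hy' hy'a (h ▸ hy'G')
  have hG'T' : G' ≠ T' := fun h => hnotT' x hx hxa (h ▸ hxG')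
  have hGT_inter : G ∩ T = {x} := ThmN.inter_eq_singleton_of_mem_trianglesThrough M hC1 hGx hTx hGT
  have hGT'_inter : G ∩ T' = {y} := ThmN.inter_eq_singleton_of_mem_trianglesThrough M hC1 hGy hT'y hGT'
  have hG'T_inter : G' ∩ T = {x} := ThmN.inter_eq_singleton_of_mem_trianglesThrough M hC1 hG'x hTx hG'T
  have hG'T'_inter : G' ∩ T' = {y'} :=
    ThmN.inter_eq_singleton_of_mem_trianglesThrough M hC1 hG'y' hT'y' hG'T'
  -- the third points `g ∈ G ∖ {x, y}`, `g' ∈ G' ∖ {x, y'}`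
  have hGfin : G.Finite := M.ground_finite.subset hG.1.subset_ground
  have hG'fin : G'.Finite := M.ground_finite.subset hG'.1.subset_ground
  obtain ⟨g, hgG, hgxy⟩ : ∃ g, g ∈ G ∧ g ∉ ({x, y} : Set α) :=
    Set.exists_mem_notMem_of_ncard_lt_ncard (by rw [hG.2, Set.ncard_pair hxy]; norm_num)
  obtain ⟨g', hg'G', hg'xy'⟩ : ∃ g', g' ∈ G' ∧ g' ∉ ({x, y'} : Set α) :=
    Set.exists_mem_notMem_of_ncard_lt_ncard (by rw [hG'.2, Set.ncard_pair hxy']; norm_num)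
  have hgx : g ≠ x := fun h => hgxy (by rw [h]; exact Set.mem_insert x {y})
  have hgy : g ≠ y := fun h => hgxy (by rw [h]; exact Set.mem_insert_of_mem x (Set.mem_singleton y))
  have hg'x : g' ≠ x := fun h => hg'xy' (by rw [h]; exact Set.mem_insert x {y'})
  have hg'y' : g' ≠ y' := fun h => hg'xy' (by rw [h]; exact Set.mem_insert_of_mem x (Set.mem_singleton y'))
  have hGeq : insert g ({x, y} : Set α) = G := by
    refine Set.eq_of_subset_of_ncard_le ?_ ?_ hGfin
    · intro z hz
      rcases hz with rfl | rfl | rfl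
      · exact hgG
      · exact hxG
      · exact hyG
    · rw [hG.2, Set.ncard_insert_of_notMem hgxy, Set.ncard_pair hxy]
  have hG'eq : insert g' ({x, y'} : Set α) = G' := by
    refine Set.eq_of_subset_of_ncard_le ?_ ?_ hG'fin
    · intro z hz
      rcases hz with rfl | rfl | rfl
      · exact hg'G'
      · exact hxG'
      · exact hy'G'
    · rw [hG'.2, Set.ncard_insert_of_notMem hg'xy', Set.ncard_pair hxy']
  -- `g`, `g'` lie in `cl (T ∪ T')`
  have hTE : T ⊆ M.E := hT.1.subset_ground
  have hT'E : T' ⊆ M.E := hT'.1.subset_ground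
  have hUE : T ∪ T' ⊆ M.E := Set.union_subset hTE hT'E
  have hgcl : g ∈ M.closure (T ∪ T') := by
    have h1 := hG.1.mem_closure_sdiff_singleton_of_mem hgG
    refine M.closure_subset_closure ?_ h1
    intro z hz
    rw [← hGeq] at hz
    obtain ⟨hz1, hz2⟩ := hz
    rcases hz1 with rfl | rfl | rfl
    · exact (hz2 (Set.mem_singleton _)).elim
    · exact Set.mem_union_left _ hx
    · exact Set.mem_union_right _ hy
  have hg'cl : g' ∈ M.closure (T ∪ T') := by
    have h1 := hG'.1.mem_closure_sdiff_singleton_of_mem hg'G'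
    refine M.closure_subset_closure ?_ h1
    intro z hz
    rw [← hG'eq] at hz
    obtain ⟨hz1, hz2⟩ := hz
    rcases hz1 with rfl | rfl | rfl
    · exact (hz2 (Set.mem_singleton _)).elim
    · exact Set.mem_union_left _ hx
    · exact Set.mem_union_right _ hy'
  -- `r(T ∪ T') ≤ 3` by submodularity
  have ha : M.IsNonloop a := isNonloop_of_mem_trianglesThrough M hT
  have hrT : M.eRk T = 2 := ThmN.eRk_eq_two_of_mem_trianglesThrough M hT
  have hrT' : M.eRk T' = 2 := ThmN.eRk_eq_two_of_mem_trianglesThrough M hT'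
  have hrU : M.eRk (T ∪ T') ≤ 3 := by
    have hsub := M.eRk_inter_add_eRk_union_le T T'
    rw [hTT', ha.eRk_eq, hrT, hrT', show (2 : ℕ∞) + 2 = 1 + 3 by norm_num] at hsub
    exact (ENat.add_le_add_iff_left (by simp)).1 hsub
  -- `T ∪ T' ∪ {g, g'}` has rank `≤ 3`, so `≤ 6` points; `|T ∪ T'| = 5` and `g ∉ T ∪ T'`, so `g' = g`
  have hScl : insert g' (insert g (T ∪ T')) ⊆ M.closure (T ∪ T') :=
    Set.insert_subset hg'cl (Set.insert_subset hgcl (M.subset_closure (T ∪ T') hUE))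
  have hSE : insert g' (insert g (T ∪ T')) ⊆ M.E := hScl.trans (M.closure_subset_ground _)
  have hSr : M.eRk (insert g' (insert g (T ∪ T'))) ≤ 3 :=
    calc M.eRk (insert g' (insert g (T ∪ T'))) ≤ M.eRk (M.closure (T ∪ T')) := M.eRk_mono hScl
      _ = M.eRk (T ∪ T') := M.eRk_closure_eq _
      _ ≤ 3 := hrU
  have hS6 : (insert g' (insert g (T ∪ T'))).ncard ≤ 6 := hC2 _ hSE hSr
  have hTfin : T.Finite := M.ground_finite.subset hTE
  have hT'fin : T'.Finite := M.ground_finite.subset hT'E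
  have hU5 : (T ∪ T').ncard = 5 := by
    have h := Set.ncard_union_add_ncard_inter T T' hTfin hT'fin
    rw [hTT', Set.ncard_singleton, hT.2.1, hT'.2.1] at h
    omega
  have hgU : g ∉ T ∪ T' := by
    rintro (hgT | hgT')
    · have hmem : g ∈ G ∩ T := ⟨hgG, hgT⟩
      rw [hGT_inter] at hmem
      exact hgx hmem
    · have hmem : g ∈ G ∩ T' := ⟨hgG, hgT'⟩
      rw [hGT'_inter] at hmem
      exact hgy hmem
  have hg'U : g' ∉ T ∪ T' := by
    rintro (hg'T | hg'T')
    · have hmem : g' ∈ G' ∩ T := ⟨hg'G', hg'T⟩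
      rw [hG'T_inter] at hmem
      exact hg'x hmem
    · have hmem : g' ∈ G' ∩ T' := ⟨hg'G', hg'T'⟩
      rw [hG'T'_inter] at hmem
      exact hg'y' hmem
  have hgg' : g' = g := by
    by_contra hne'
    have hg'notin : g' ∉ insert g (T ∪ T') := by
      rintro (h | h)
      · exact hne' h
      · exact hg'U h
    have h7 : (insert g' (insert g (T ∪ T'))).ncard = 7 := by
      rw [Set.ncard_insert_of_notMem hg'notin ((hTfin.union hT'fin).insert g),
        Set.ncard_insert_of_notMem hgU (hTfin.union hT'fin), hU5]
    omega
  -- `G` and `G'` are triangles through `x` sharing `g ≠ x`, so `G = G'`, and `y' ∈ G = {x, y, g}`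
  have hgG' : g ∈ G' := by rw [← hgg']; exact hg'G'
  have hgy' : g ≠ y' := by rw [← hgg']; exact hg'y'
  have hGG' : G = G' := eq_of_mem_trianglesThrough_of_mem M hC1 hGx hG'x hgG hgG' hgx
  rw [← hGG', ← hGeq] at hy'G'
  rcases hy'G' with h | h | h
  · exact hgy' h.symm
  · exact hxy' h.symm
  · exact hyy' h.symm

open Classical in
/-- **Two uncovered cross pairs**: for triangles `T ≠ T'` through `a` with `T ∖ a = {b, c}`, `T' ∖ a = {d, e}`,
at least two of the four cross pairs `{b, d}, {b, e}, {c, d}, {c, e}` are covered by no triangle. -/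
theorem two_le_sum_uncovered_cross [DecidableEq α] (M : Matroid α) [M.Finite]
    (hC1 : ∀ L ⊆ M.E, M.eRk L = 2 → L.ncard ≤ 3) (hC2 : ∀ P ⊆ M.E, M.eRk P ≤ 3 → P.ncard ≤ 6)
    {a : α} {T T' : Set α} (hT : T ∈ ThmN.trianglesThrough M a) (hT' : T' ∈ ThmN.trianglesThrough M a)
    (hne : T ≠ T') {b c d e : α} (hb : b ∈ T) (hba : b ≠ a) (hc : c ∈ T) (hca : c ≠ a) (hbc : b ≠ c)
    (hd : d ∈ T') (hda : d ≠ a) (he : e ∈ T') (hea : e ≠ a) (hde : d ≠ e) :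
    2 ≤ ∑ x ∈ ({b, c} : Finset α), ∑ y ∈ ({d, e} : Finset α), (if covered M x y then 0 else 1) := by
  classical
  have h1 := not_covered_both M hC1 hC2 hT hT' hne hb hba hd hda he hea hde
  have h2 := not_covered_both M hC1 hC2 hT hT' hne hc hca hd hda he hea hde
  have h3 := not_covered_both M hC1 hC2 hT' hT hne.symm hd hda hb hba hc hca hbc
  have h4 := not_covered_both M hC1 hC2 hT' hT hne.symm he hea hb hba hc hca hbc
  rw [covered_comm M (x := d) (y := b), covered_comm M (x := d) (y := c)] at h3
  rw [covered_comm M (x := e) (y := b), covered_comm M (x := e) (y := c)] at h4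
  rw [Finset.sum_pair hbc, Finset.sum_pair hde, Finset.sum_pair hde]
  split_ifs <;> first | omega | (exfalso; tauto)

end S1

end PercRepro
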